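import Literature.Analysis.FunctionSpaces.PolchinskiReparam
import Literature.Analysis.FunctionSpaces.PolchinskiDualGenerator
import Mathlib.Analysis.SpecialFunctions.Log.Deriv
import HarnessLib

/-!
# The backward identity `−∂_s P_{s,t}F = P_{s,t}(L_sF)` (Bauerschmidt–Bodineau–Dagallier, Proposition 8,
# via the compressed decomposition)

Topic `Literature/Analysis/FunctionSpaces`; thirteenth "proof architecture" file behind the named fact
`Polchinski.BauerschmidtBodineau_multiscaleBakryEmery` ([BBD] Theorem 3, `MultiscaleBakryEmery.lean`).
[BBD] Prop 8 (e:polchinski-generator) states, for `s < t`, the two identities `∂_tP_{s,t}F = L_tP_{s,t}F`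
(`PolchinskiGenerator.lean`, `PolchinskiGeneratorGeneral.lean`) and `−∂_sP_{s,t}F = P_{s,t}(L_sF)`.  The
second is the derivative IN THE INITIAL SCALE `s` of
`P_{s,t}F(φ) = e^{V_t(φ)} E_{C_t−C_s}[e^{−V_s(φ+ζ)}F(φ+ζ)]`, where `s` enters through the shrinking bridge
covariance `C_t − C_s` and through the density `e^{−V_s}`.  This is exactly the situation of the dual
identity `d/dt E_{ν_t}[F] = −E_{ν_t}[L_tF]` (`hasDerivAt_renormExpect`, `PolchinskiDualGenerator.lean`:
covariance `C_∞ − C_t`, density `e^{−V_t}`) for the decomposition COMPRESSED onto `[0,t]`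
(`CovDecomposition.compress`, [BBD] Remark 2: `C''_r = C_{a(r)}`, `C''_∞ = C_t`, `Ċ''_r = ȧ(r)Ċ_{a(r)}`),
read at `r = a^{-1}(s)` and transported back by the chain rule (`ȧ(a^{-1}(s))·(a^{-1})'(s) = 1`).

## Main results (sorry-free; no new definitions, no new named facts)

* `hasDerivAt_integral_bridge` — for `0 < s < t`:
  `∂_s E_{C_t−C_s}[e^{−V_s}F] = −E_{C_t−C_s}[e^{−V_s} L_sF]`,
  `L_sF = ½ Σ Ċ_s^{ij}∂_i∂_jF − Σ Ċ_s^{ij} ∂_iV_s ∂_jF`, `∇V_s = −∇Z_s/Z_s`.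
* **`hasDerivAt_semigroup_backward`** — `−∂_s P_{s,t}F(φ) = P_{s,t}(L_sF)(φ)` ([BBD] (e:polchinski-generator),
  second identity), at every base point `φ` (by translating `V₀` and `F`).

Nothing here concerns Yang–Mills.

## References

* [BauerschmidtBodineauDagallier2023] R. Bauerschmidt, T. Bodineau, B. Dagallier, Probab. Surveys 21
  (2024) 200–290, arXiv:2307.07619 — Prop 8 p0014 L91–104, Remark 2 p0015 L100 – p0016 L9. READ (held).
-/

noncomputable section

-- nested operator-norm instances `E →L[ℝ] E →L[ℝ] ℝ`
set_option maxSynthPendingDepth 2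

open MeasureTheory ProbabilityTheory Filter Topology Set
open scoped RealInnerProductSpace Matrix MatrixOrder

namespace Literature.Analysis.FunctionSpaces

namespace Polchinski

variable {N : ℕ}

section Backward

variable (D : CovDecomposition N) {V₀ : EuclideanSpace ℝ (Fin N) → ℝ}
  {D1 : EuclideanSpace ℝ (Fin N) → EuclideanSpace ℝ (Fin N) →L[ℝ] ℝ}
  {D2 : EuclideanSpace ℝ (Fin N) → EuclideanSpace ℝ (Fin N) →L[ℝ] EuclideanSpace ℝ (Fin N) →L[ℝ] ℝ}
  {F : EuclideanSpace ℝ (Fin N) → ℝ}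
  {DF : EuclideanSpace ℝ (Fin N) → EuclideanSpace ℝ (Fin N) →L[ℝ] ℝ}
  {D2F : EuclideanSpace ℝ (Fin N) → EuclideanSpace ℝ (Fin N) →L[ℝ] EuclideanSpace ℝ (Fin N) →L[ℝ] ℝ}

/-- Translation of the initial potential: `V_s[V₀(φ+·)](ζ) = V_s[V₀](φ+ζ)`.
[cite: BauerschmidtBodineauDagallier2023, Definition 2] -/
theorem renormPotential_translate (φ : EuclideanSpace ℝ (Fin N)) (s : ℝ) (ζ : EuclideanSpace ℝ (Fin N)) :
    renormPotential D (fun x => V₀ (φ + x)) s ζ = renormPotential D V₀ s (φ + ζ) := by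
  unfold renormPotential
  simp only [add_assoc]

/-- **The bridge derivative** ([BBD] Prop 8, second identity, at the base point `0`): for `0 < s < t`,
`V₀` bounded below with `e^{−V₀} ∈ C_b²` and `F ∈ C_b²` (bounded, `∇F` bounded, `D²F` bounded uniformly
continuous),
`∂_s E_{C_t−C_s}[e^{−V_s}F] = −E_{C_t−C_s}[e^{−V_s} L_sF]`,
`L_sF(ζ) = ½ Σ Ċ_s^{ij} D²F(ζ)(e_i,e_j) − Σ Ċ_s^{ij} ∂_iV_s(ζ) DF(ζ)(e_j)`, `∇V_s = −∇Z_s/Z_s`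
(`hasFDerivAt_renormPotential`).  Proof: `hasDerivAt_renormExpect` for `CovDecomposition.compress D t`
at `r = −log(1 − s/t)` (`a(r) = s`, `ȧ(r) = t − s`), chain rule with `r(s)' = 1/(t − s)`.
[cite: BauerschmidtBodineauDagallier2023, Proposition 8] -/
theorem hasDerivAt_integral_bridge
    (hG1 : ∀ x, HasFDerivAt (fun x => Real.exp (-V₀ x)) (D1 x) x)
    (hG2 : ∀ x, HasFDerivAt D1 (D2 x) x) {b : ℝ} (hb : ∀ φ, b ≤ V₀ φ)
    {K1 : ℝ} (hK1 : ∀ x, ‖D1 x‖ ≤ K1) {M : ℝ} (hM : ∀ x, ‖D2 x‖ ≤ M) (hUC : UniformContinuous D2)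
    (hF1 : ∀ x, HasFDerivAt F (DF x) x) (hF2 : ∀ x, HasFDerivAt DF (D2F x) x)
    {KF : ℝ} (hFb : ∀ x, |F x| ≤ KF) {LF : ℝ} (hDF : ∀ x, ‖DF x‖ ≤ LF)
    {MF : ℝ} (hD2F : ∀ x, ‖D2F x‖ ≤ MF) (hUCF : UniformContinuous D2F)
    {s t : ℝ} (hs : 0 < s) (hst : s < t) :
    HasDerivAt (fun s' => ∫ ζ, Real.exp (-renormPotential D V₀ s' ζ) * F ζ
        ∂(multivariateGaussian 0 (D.C t - D.C s')))
      (-(∫ ζ, Real.exp (-renormPotential D V₀ s ζ) *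
          ((1 / 2) * ∑ i, ∑ j, D.Cdot s i j *
              D2F ζ (EuclideanSpace.single i 1) (EuclideanSpace.single j 1) -
            ∑ i, ∑ j, D.Cdot s i j *
              (-((∫ ζ', Real.exp (-V₀ (ζ + ζ')) ∂(multivariateGaussian 0 (D.C s)))⁻¹ •
                  ∫ ζ', D1 (ζ + ζ') ∂(multivariateGaussian 0 (D.C s)))) (EuclideanSpace.single i 1) *
                DF ζ (EuclideanSpace.single j 1))
          ∂(multivariateGaussian 0 (D.C t - D.C s)))) s := by
  have ht : 0 < t := hs.trans hst
  have hts : 0 < t - s := sub_pos.2 hst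
  have hq : 0 < 1 - s / t := by
    rw [sub_pos, div_lt_one ht]; exact hst
  -- the parameter `r₀ = a^{-1}(s)` of the compressed decomposition
  set r₀ : ℝ := -Real.log (1 - s / t) with hr₀def
  have hr₀ : 0 < r₀ := by
    rw [hr₀def, neg_pos]
    exact Real.log_neg hq (by rw [sub_lt_self_iff]; positivity)
  have hexp_r₀ : Real.exp (-r₀) = 1 - s / t := by
    rw [hr₀def, neg_neg, Real.exp_log hq]
  have hab : CovDecomposition.compressTime t r₀ = s := by
    unfold CovDecomposition.compressTime
    rw [hexp_r₀]; field_simp; ring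
  have hadot : t * Real.exp (-r₀) = t - s := by
    rw [hexp_r₀]; field_simp
  -- `hasDerivAt_renormExpect` for the compressed decomposition at `r₀`
  have h72 := hasDerivAt_renormExpect (D.compress t ht) hG1 hG2 hb hK1 hM hUC hF1 hF2 hFb hDF hD2F hUCF hr₀
  -- the inverse time change `B(s') = −log(1 − s'/t)` near `s`
  have hB : HasDerivAt (fun s' : ℝ => -Real.log (1 - s' / t)) (1 / (t - s)) s := by
    have h1 : HasDerivAt (fun s' : ℝ => 1 - s' / t) (-(1 / t)) s := by
      simpa using ((hasDerivAt_id s).div_const t).const_sub 1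
    have h2 := (h1.log hq.ne').neg
    refine h2.congr_deriv ?_
    field_simp
  have hcomp := h72.comp s hB
  -- identify the composite with `s' ↦ e^{V_t(0)} E_{C_t−C_{s'}}[e^{−V_{s'}}F]` near `s`
  have hev : ∀ᶠ s' in 𝓝 s, s' < t := Iio_mem_nhds hst
  have hfun : (fun s' => Real.exp (renormPotential D V₀ t 0) *
      ∫ ζ, Real.exp (-renormPotential D V₀ s' ζ) * F ζ ∂(multivariateGaussian 0 (D.C t - D.C s'))) =ᶠ[𝓝 s]
      ((fun r' => renormExpect (D.compress t ht) V₀ r' F) ∘ fun s' : ℝ => -Real.log (1 - s' / t)) := by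
    filter_upwards [hev] with s' hs'
    have hq' : 0 < 1 - s' / t := by rw [sub_pos, div_lt_one ht]; exact hs'
    have hab' : CovDecomposition.compressTime t (-Real.log (1 - s' / t)) = s' := by
      unfold CovDecomposition.compressTime
      rw [neg_neg, Real.exp_log hq']; field_simp; ring
    simp only [Function.comp, renormExpect_compress, hab']
  have hg := hcomp.congr_of_eventuallyEq hfun
  -- remove the normalisation `e^{V_t(0)}`
  have hg' := hg.const_mul (Real.exp (-renormPotential D V₀ t 0))
  have hcancel : ∀ x : ℝ, Real.exp (-renormPotential D V₀ t 0) * (Real.exp (renormPotential D V₀ t 0) * x) = x :=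
    fun x => by rw [← mul_assoc, ← Real.exp_add, neg_add_cancel, Real.exp_zero, one_mul]
  simp_rw [hcancel] at hg'
  refine hg'.congr_deriv ?_
  -- identify the coefficients: `a(r₀) = s`, `ȧ(r₀) = t − s`, `C''_∞ = C_t`
  simp only [renormExpect_compress, CovDecomposition.compress_Cdot, CovDecomposition.compress_C, hab, hadot,
    Matrix.smul_apply, smul_eq_mul]
  have hpt : ∀ ζ : EuclideanSpace ℝ (Fin N),
      Real.exp (-renormPotential D V₀ s ζ) *
        ((1 / 2) * ∑ i, ∑ j, (t - s) * D.Cdot s i j *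
            D2F ζ (EuclideanSpace.single i 1) (EuclideanSpace.single j 1) -
          ∑ i, ∑ j, (t - s) * D.Cdot s i j *
            (-((∫ ζ', Real.exp (-V₀ (ζ + ζ')) ∂(multivariateGaussian 0 (D.C s)))⁻¹ •
                ∫ ζ', D1 (ζ + ζ') ∂(multivariateGaussian 0 (D.C s)))) (EuclideanSpace.single i 1) *
              DF ζ (EuclideanSpace.single j 1)) =
      (t - s) * (Real.exp (-renormPotential D V₀ s ζ) *
        ((1 / 2) * ∑ i, ∑ j, D.Cdot s i j *
            D2F ζ (EuclideanSpace.single i 1) (EuclideanSpace.single j 1) -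
          ∑ i, ∑ j, D.Cdot s i j *
            (-((∫ ζ', Real.exp (-V₀ (ζ + ζ')) ∂(multivariateGaussian 0 (D.C s)))⁻¹ •
                ∫ ζ', D1 (ζ + ζ') ∂(multivariateGaussian 0 (D.C s)))) (EuclideanSpace.single i 1) *
              DF ζ (EuclideanSpace.single j 1))) := by
    intro ζ
    simp only [mul_assoc, ← Finset.mul_sum]
    ring
  simp_rw [hpt, integral_const_mul]
  have halg : ∀ X : ℝ, Real.exp (-renormPotential D V₀ t 0) *
      (-(Real.exp (renormPotential D V₀ t 0) * ((t - s) * X)) * (1 / (t - s))) = -X := by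
    intro X
    have hE : Real.exp (-renormPotential D V₀ t 0) * Real.exp (renormPotential D V₀ t 0) = 1 := by
      rw [← Real.exp_add, neg_add_cancel, Real.exp_zero]
    have hne : t - s ≠ 0 := hts.ne'
    calc _ = -(Real.exp (-renormPotential D V₀ t 0) * Real.exp (renormPotential D V₀ t 0)) *
          ((t - s) * (1 / (t - s))) * X := by ring
      _ = -X := by rw [hE, mul_one_div_cancel hne]; ring
  exact halg _

/-- **[BBD] Proposition 8 — the backward identity `−∂_s P_{s,t}F = P_{s,t}(L_sF)`** ((e:polchinski-generator),
second identity), for `0 < s < t`, at every base point `φ`: under the hypotheses of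
`hasDerivAt_integral_bridge`,
`∂_s P_{s,t}F(φ) = −P_{s,t}(L_sF)(φ)`, `L_sF(y) = ½ Σ Ċ_s^{ij} D²F(y)(e_i,e_j) − Σ Ċ_s^{ij} ∂_iV_s(y) DF(y)(e_j)`
with `∇V_s(y) = −∇Z_s(y)/Z_s(y)` (`hasFDerivAt_renormPotential`).  Obtained from `hasDerivAt_integral_bridge`
for the translated data `V₀(φ+·)`, `F(φ+·)`. [cite: BauerschmidtBodineauDagallier2023, Proposition 8] -/
theorem hasDerivAt_semigroup_backward
    (hG1 : ∀ x, HasFDerivAt (fun x => Real.exp (-V₀ x)) (D1 x) x)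
    (hG2 : ∀ x, HasFDerivAt D1 (D2 x) x) {b : ℝ} (hb : ∀ φ, b ≤ V₀ φ)
    {K1 : ℝ} (hK1 : ∀ x, ‖D1 x‖ ≤ K1) {M : ℝ} (hM : ∀ x, ‖D2 x‖ ≤ M) (hUC : UniformContinuous D2)
    (hF1 : ∀ x, HasFDerivAt F (DF x) x) (hF2 : ∀ x, HasFDerivAt DF (D2F x) x)
    {KF : ℝ} (hFb : ∀ x, |F x| ≤ KF) {LF : ℝ} (hDF : ∀ x, ‖DF x‖ ≤ LF)
    {MF : ℝ} (hD2F : ∀ x, ‖D2F x‖ ≤ MF) (hUCF : UniformContinuous D2F)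
    {s t : ℝ} (hs : 0 < s) (hst : s < t) (φ : EuclideanSpace ℝ (Fin N)) :
    HasDerivAt (fun s' => semigroup D V₀ s' t F φ)
      (-(semigroup D V₀ s t (fun y =>
          (1 / 2) * ∑ i, ∑ j, D.Cdot s i j *
              D2F y (EuclideanSpace.single i 1) (EuclideanSpace.single j 1) -
            ∑ i, ∑ j, D.Cdot s i j *
              (-((∫ ζ', Real.exp (-V₀ (y + ζ')) ∂(multivariateGaussian 0 (D.C s)))⁻¹ •
                  ∫ ζ', D1 (y + ζ') ∂(multivariateGaussian 0 (D.C s)))) (EuclideanSpace.single i 1) *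
                DF y (EuclideanSpace.single j 1)) φ)) s := by
  -- translated data
  have hT : ∀ x : EuclideanSpace ℝ (Fin N), HasFDerivAt (fun x : EuclideanSpace ℝ (Fin N) => φ + x)
      (ContinuousLinearMap.id ℝ _) x := fun x => (hasFDerivAt_id x).const_add φ
  have hG1' : ∀ x, HasFDerivAt (fun x => Real.exp (-V₀ (φ + x))) (D1 (φ + x)) x := fun x => by
    have h := (hG1 (φ + x)).comp x (hT x)
    rw [ContinuousLinearMap.comp_id] at h
    exact h
  have hG2' : ∀ x, HasFDerivAt (fun x => D1 (φ + x)) (D2 (φ + x)) x := fun x => by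
    have h := (hG2 (φ + x)).comp x (hT x)
    rw [ContinuousLinearMap.comp_id] at h
    exact h
  have hF1' : ∀ x, HasFDerivAt (fun x => F (φ + x)) (DF (φ + x)) x := fun x => by
    have h := (hF1 (φ + x)).comp x (hT x)
    rw [ContinuousLinearMap.comp_id] at h
    exact h
  have hF2' : ∀ x, HasFDerivAt (fun x => DF (φ + x)) (D2F (φ + x)) x := fun x => by
    have h := (hF2 (φ + x)).comp x (hT x)
    rw [ContinuousLinearMap.comp_id] at h
    exact h
  have huc : UniformContinuous fun x : EuclideanSpace ℝ (Fin N) => φ + x :=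
    uniformContinuous_const.add uniformContinuous_id
  have h := hasDerivAt_integral_bridge D hG1' hG2' (fun x => hb (φ + x)) (fun x => hK1 (φ + x))
    (fun x => hM (φ + x)) (hUC.comp huc) hF1' hF2' (fun x => hFb (φ + x)) (fun x => hDF (φ + x))
    (fun x => hD2F (φ + x)) (hUCF.comp huc) hs hst
  simp_rw [renormPotential_translate] at h
  have h2 := h.const_mul (Real.exp (renormPotential D V₀ t φ))
  unfold semigroup
  refine h2.congr_deriv ?_
  simp only [add_assoc, mul_neg]

end Backward

end Polchinski

end Literature.Analysis.FunctionSpaces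

end
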